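import Summits.AtomisticToContinuum.Crystallization.Theorems.OverbindingBudgetAffineCompressedCutChartsA

/-!
# OverbindingBudget · AffineCompressedCut — «Charts» (lens-4 g81 rider 2 of R1 «ExactStep»): part 2 of 2 (sequel of `…CompressedCutChartsA`, whose module docstring describes the rider)

Split for the 400-line cap by the landing lane (hand-2 g37).  This part: §4 registration and the child's chart, §5 the packaged kernel steps and independence from an integer determinant.
Same namespace, opens and variables; all FQNs unchanged; bodies verbatim (plus one private twin of part A's private `ne_of_norm_sub_eq_one`, see below).  0 sorry; standard axioms.
-/

namespace Summit.AtomisticToContinuum.Crystallization.Theorems.OverbindingBudgetAffineCompressedCutCharts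

open Literature.Geometry.DiscreteGeometry (sqNormInt intVec intVec_sub intVec_injective det3Int cramerInt fccModelInt hcpModelInt fccTwoShellPattern
  hcpTwoShellPattern fccTwoShellPattern_eq_image hcpTwoShellPattern_eq_image norm_sq_intVec_div)
open Summit.AtomisticToContinuum.Crystallization.Theorems.OverbindingBudgetAffineCompressedCutKernel (T3 tsub tadd tneg tscale tsq tdet tpull toV
  toV_apply_zero toV_apply_one toV_apply_two toV_tsub toV_tadd toV_tneg toV_tscale tsq_eq tdet_eq toV_tpull toV_injective RegAt PullsInto TetraAt UnitTriple
  tetraPick kernelOneB kernelTwoB kernelOneB_sound kernelTwoB_sound capL fccL hcpL mem_fccModelInt_iff mem_hcpModelInt_iff)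
open Summit.AtomisticToContinuum.Crystallization.Theorems.OverbindingBudgetAffineCompressedCutTransfer (model_cramer tetra_det)
open Summit.AtomisticToContinuum.Crystallization.Theorems.OverbindingBudgetAffineCompressedCutExact (ExactDict)

variable {N : ℕ}

/-- Pattern points at norm distance `1` are distinct.  [private twin of the part-A lemma of the same name (`…CompressedCutChartsA`, private there), added by the
landing lane because a `private` declaration is not visible across the 400-line split; statement and body verbatim] -/
private theorem ne_of_norm_sub_eq_one {v w : EuclideanSpace ℝ (Fin 3)} (h : ‖v - w‖ = 1) : v ≠ w := fun e => by
  rw [e, sub_self, norm_zero] at h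
  exact zero_ne_one h

/-! ## §4  Registration and the child's chart -/

/-- ★ **REGISTRATION FROM THE DICTIONARY.**  A parent carried onto the copy `Cp` by `Gp`, its point `v_k` registering the child charted to `mv xr` (the child's
offset from this parent in aligned model coordinates), a chart-form dictionary towards the child chart `G`, the child's pattern listed by `S`, and the pull-back
formula `mv (tpull u w W) = d • G (mv W)` (`mv_tpull`): then the kernel's registration hypothesis `RegAt Cp S xr u w` holds — every point of the parent's
pattern-with-centre adjacent to the child is, as a vector from the child, a pulled-back child point. [this file] -/
theorem regAt_of_chartDict {G Gp : EuclideanSpace ℝ (Fin 3) →ₗᵢ[ℝ] EuclideanSpace ℝ (Fin 3)} {Pp P' : Finset (EuclideanSpace ℝ (Fin 3))}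
    {vkp : EuclideanSpace ℝ (Fin 3)} {Cp S : List T3} {xr u₁ u₂ u₃ w₁ w₂ w₃ : T3}
    (hD : ChartDict G Gp Pp vkp P') (hback : ∀ V ∈ Cp, ∃ v ∈ Pp, Gp v = mv V) (hx : Gp vkp = mv xr)
    (hS : ∀ w ∈ P', ∃ W ∈ S, w = mv W) (hpull : ∀ W, mv (tpull u₁ u₂ u₃ w₁ w₂ w₃ W) = (tdet w₁ w₂ w₃ : ℝ) • G (mv W)) :
    RegAt Cp S xr u₁ u₂ u₃ w₁ w₂ w₃ := by
  intro V hV h18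
  have hreal : ∃ w ∈ P', G w = mv V - mv xr := by
    rcases List.mem_cons.1 hV with rfl | hV'
    · obtain ⟨w, hw, hGw⟩ := hD.1
      exact ⟨w, hw, by rw [hGw, hx, mv_zero, zero_sub]⟩
    · obtain ⟨v, hv, hGv⟩ := hback V hV'
      have n1 : ‖v - vkp‖ = 1 := by rw [← Gp.norm_map, map_sub, hGv, hx, ← mv_tsub, norm_mv_eq_one_iff]; exact h18
      obtain ⟨w, hw, hGw⟩ := hD.2 v hv (ne_of_norm_sub_eq_one n1) (by rw [n1]; norm_num)
      exact ⟨w, hw, by rw [hGw, hGv, hx]⟩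
  obtain ⟨w, hw, hGw⟩ := hreal
  obtain ⟨W, hW, rfl⟩ := hS w hw
  refine ⟨W, hW, mv_injective ?_⟩
  rw [hpull, hGw, mv_tscale, mv_tsub]

/-- ★ **THE CHILD'S CHART FROM THE KERNEL'S CONCLUSION.**  If the child's list `S` pulls back into `d • Q` (`PullsInto Q S u w`, the conclusion of
`kernelOneB_sound` / `kernelTwoB_sound`), with the pull-back formula and `d ≠ 0`, then the child chart `G` carries the child's pattern `P'` (listed by `S`,
eighteen points) onto the copy `Q` (at most eighteen entries): forward by injectivity of `mv`, backward by counting. [this file] -/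
theorem carries_of_pullsInto {G : EuclideanSpace ℝ (Fin 3) →ₗᵢ[ℝ] EuclideanSpace ℝ (Fin 3)} {P' : Finset (EuclideanSpace ℝ (Fin 3))} {Q S : List T3}
    {u₁ u₂ u₃ w₁ w₂ w₃ : T3} (hQ : PullsInto Q S u₁ u₂ u₃ w₁ w₂ w₃)
    (hpull : ∀ W, mv (tpull u₁ u₂ u₃ w₁ w₂ w₃ W) = (tdet w₁ w₂ w₃ : ℝ) • G (mv W)) (hd : tdet w₁ w₂ w₃ ≠ 0)
    (hS : ∀ w ∈ P', ∃ W ∈ S, w = mv W) (hcard : P'.card = 18) (hQl : Q.length ≤ 18) : Carries G P' Q := by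
  classical
  have hdR : (tdet w₁ w₂ w₃ : ℝ) ≠ 0 := by exact_mod_cast hd
  have fwd : ∀ w ∈ P', ∃ V ∈ Q, G w = mv V := by
    intro w hw
    obtain ⟨W, hW, rfl⟩ := hS w hw
    obtain ⟨V, hV, hVW⟩ := hQ W hW
    refine ⟨V, hV, smul_right_injective (EuclideanSpace ℝ (Fin 3)) hdR ?_⟩
    show (tdet w₁ w₂ w₃ : ℝ) • G (mv W) = (tdet w₁ w₂ w₃ : ℝ) • mv V
    rw [← hpull, hVW, mv_tscale]
  refine ⟨fwd, fun V hV => ?_⟩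
  have hsub : P'.image G ⊆ (Q.map mv).toFinset := by
    intro z hz
    obtain ⟨w, hw, rfl⟩ := Finset.mem_image.1 hz
    obtain ⟨V', hV', hGV'⟩ := fwd w hw
    rw [List.mem_toFinset, List.mem_map]
    exact ⟨V', hV', hGV'.symm⟩
  have hcardI : (P'.image G).card = 18 := by rw [Finset.card_image_of_injective _ G.injective, hcard]
  have hle : (Q.map mv).toFinset.card ≤ 18 := (List.toFinset_card_le _).trans (by rw [List.length_map]; exact hQl)
  have heq : P'.image G = (Q.map mv).toFinset := Finset.eq_of_subset_of_card_le hsub (by rw [hcardI]; exact hle)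
  have hmem : mv V ∈ P'.image G := by
    rw [heq, List.mem_toFinset, List.mem_map]
    exact ⟨V, hV, rfl⟩
  obtain ⟨v, hv, hGv⟩ := Finset.mem_image.1 hmem
  exact ⟨v, hv, hGv⟩

/-! ## §5  The packaged kernel steps; independence from an integer determinant -/

/-- ★★ **SINGLE-PARENT KERNEL STEP.**  A table entry `kernelOneB Cp xs S Qs = true` (e.g. `kf_fcc`, `kf_hcp`, `e1_entries`), a parent with pattern `Pp` carried onto
`Cp` by `Gp`, a child along `v_k ↦ x ∈ xs`, a chart-form dictionary towards the child chart `G`, the child's pattern `P'` (eighteen points) listed by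
`S ∈ {fccL, hcpL}`, copies of at most eighteen entries: then `G` carries `P'` onto some copy `Q ∈ Qs`. [this file] -/
theorem kernel_step_one {Cp xs S : List T3} {Qs : List (List T3)} (hK : kernelOneB Cp xs S Qs = true)
    {G Gp : EuclideanSpace ℝ (Fin 3) →ₗᵢ[ℝ] EuclideanSpace ℝ (Fin 3)} {Pp P' : Finset (EuclideanSpace ℝ (Fin 3))} {vkp : EuclideanSpace ℝ (Fin 3)} {x : T3}
    (hx : x ∈ xs) (hD : ChartDict G Gp Pp vkp P') (hCp : Carries Gp Pp Cp) (hGx : Gp vkp = mv x) (hvk1 : ‖vkp‖ = 1)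
    (hS : S = fccL ∨ S = hcpL) (hL : ListedBy P' S) (hcard : P'.card = 18) (hQs : ∀ Q ∈ Qs, Q.length ≤ 18) :
    ∃ Q ∈ Qs, Carries G P' Q := by
  obtain ⟨hb, hc, ht, hmain⟩ := kernelOneB_sound hK hx
  obtain ⟨W₁, hW₁, W₂, hW₂, W₃, hW₃, hu, e₁, e₂, e₃⟩ := exists_unitTriple_of_chartDict hD hCp.2 hGx hvk1 hb hc ht hL.1
  have hd : tdet W₁ W₂ W₃ ≠ 0 := by
    rcases tdet_of_unitTriple hS hW₁ hW₂ hW₃ hu with h | h <;> rw [h] <;> norm_num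
  have hpull := mv_tpull e₁ e₂ e₃ hd
  obtain ⟨Q, hQ, hP⟩ := hmain hW₁ hW₂ hW₃ hu (regAt_of_chartDict hD hCp.2 hGx hL.1 hpull)
  exact ⟨Q, hQ, carries_of_pullsInto hP hpull hd hL.1 hcard (hQs Q hQ)⟩

/-- ★★ **TWO-PARENT KERNEL STEP** (cap form, e.g. the stacking tables `…KernelStackF/H`).  A table entry `kernelTwoB Cp s S Qs = true`, a child at the cap point
`x` of a first parent (`Gp`, pattern `Pp`, centre at `0`) and, for another cap point `x₂ ≠ x`, a SECOND parent (`Gp₂`, pattern `Pp₂`, carried onto the SAME copy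
`Cp`) whose registering point is charted to `mv x₂`, BOTH with chart-form dictionaries towards the same child chart `G` (the second through the cocycle,
`chartDict_of_cocycle`): then `G` carries the child's pattern onto some `Q ∈ Qs`. [this file] -/
theorem kernel_step_two {Cp S : List T3} {s : ℤ} {Qs : List (List T3)} (hK : kernelTwoB Cp s S Qs = true)
    {G Gp Gp₂ : EuclideanSpace ℝ (Fin 3) →ₗᵢ[ℝ] EuclideanSpace ℝ (Fin 3)} {Pp Pp₂ P' : Finset (EuclideanSpace ℝ (Fin 3))}
    {vkp vkp₂ : EuclideanSpace ℝ (Fin 3)} {x x₂ : T3}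
    (hx : x ∈ capL Cp s) (hx₂ : x₂ ∈ capL Cp s) (hne : x ≠ x₂)
    (hD : ChartDict G Gp Pp vkp P') (hCp : Carries Gp Pp Cp) (hGx : Gp vkp = mv x) (hvk1 : ‖vkp‖ = 1)
    (hD₂ : ChartDict G Gp₂ Pp₂ vkp₂ P') (hCp₂ : Carries Gp₂ Pp₂ Cp) (hGx₂ : Gp₂ vkp₂ = mv x₂)
    (hS : S = fccL ∨ S = hcpL) (hL : ListedBy P' S) (hcard : P'.card = 18) (hQs : ∀ Q ∈ Qs, Q.length ≤ 18) :
    ∃ Q ∈ Qs, Carries G P' Q := by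
  obtain ⟨hb, hc, ht, hmain⟩ := kernelTwoB_sound hK hx hx₂ hne
  have hb' : (tetraPick Cp x).1 ∈ Cp := hb
  obtain ⟨W₁, hW₁, W₂, hW₂, W₃, hW₃, hu, e₁, e₂, e₃⟩ := exists_unitTriple_of_chartDict hD hCp.2 hGx hvk1 hb' hc ht hL.1
  have hd : tdet W₁ W₂ W₃ ≠ 0 := by
    rcases tdet_of_unitTriple hS hW₁ hW₂ hW₃ hu with h | h <;> rw [h] <;> norm_num
  have hpull := mv_tpull e₁ e₂ e₃ hd
  obtain ⟨Q, hQ, hP⟩ := hmain hW₁ hW₂ hW₃ hu (regAt_of_chartDict hD hCp.2 hGx hL.1 hpull) (regAt_of_chartDict hD₂ hCp₂.2 hGx₂ hL.1 hpull)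
  exact ⟨Q, hQ, carries_of_pullsInto hP hpull hd hL.1 hcard (hQs Q hQ)⟩

/-- Three model points with non-zero integer determinant are linearly independent. [this file] -/
theorem linearIndependent_mv {X Y Z : T3} (hd : tdet X Y Z ≠ 0) : LinearIndependent ℝ ![mv X, mv Y, mv Z] := by
  rw [Fintype.linearIndependent_iff]
  intro g hg
  have hc : ∀ i : Fin 3, g 0 * ((Real.sqrt 18)⁻¹ * (toV X i : ℝ)) + g 1 * ((Real.sqrt 18)⁻¹ * (toV Y i : ℝ))
      + g 2 * ((Real.sqrt 18)⁻¹ * (toV Z i : ℝ)) = 0 := by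
    intro i
    have h := congrArg (fun v : EuclideanSpace ℝ (Fin 3) => v i) hg
    simpa [Fin.sum_univ_three, mv, intVec] using h
  have h0 := hc 0
  have h1 := hc 1
  have h2 := hc 2
  simp only [toV_apply_zero, toV_apply_one, toV_apply_two] at h0 h1 h2
  have hs : (Real.sqrt 18)⁻¹ ≠ 0 := inv_ne_zero (Real.sqrt_ne_zero'.2 (by norm_num))
  have hdR : (tdet X Y Z : ℝ) ≠ 0 := by exact_mod_cast hd
  obtain ⟨x₁, x₂, x₃⟩ := X
  obtain ⟨y₁, y₂, y₃⟩ := Y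
  obtain ⟨z₁, z₂, z₃⟩ := Z
  simp only [tdet] at hdR
  push_cast at hdR h0 h1 h2
  have e0 : g 0 * ((Real.sqrt 18)⁻¹ * (x₁ * (y₂ * z₃ - y₃ * z₂) - y₁ * (x₂ * z₃ - x₃ * z₂) + z₁ * (x₂ * y₃ - x₃ * y₂))) = 0 := by
    linear_combination (y₂ * z₃ - y₃ * z₂) * h0 + (y₃ * z₁ - y₁ * z₃) * h1 + (y₁ * z₂ - y₂ * z₁) * h2
  have e1 : g 1 * ((Real.sqrt 18)⁻¹ * (x₁ * (y₂ * z₃ - y₃ * z₂) - y₁ * (x₂ * z₃ - x₃ * z₂) + z₁ * (x₂ * y₃ - x₃ * y₂))) = 0 := by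
    linear_combination (z₂ * x₃ - z₃ * x₂) * h0 + (z₃ * x₁ - z₁ * x₃) * h1 + (z₁ * x₂ - z₂ * x₁) * h2
  have e2 : g 2 * ((Real.sqrt 18)⁻¹ * (x₁ * (y₂ * z₃ - y₃ * z₂) - y₁ * (x₂ * z₃ - x₃ * z₂) + z₁ * (x₂ * y₃ - x₃ * y₂))) = 0 := by
    linear_combination (x₂ * y₃ - x₃ * y₂) * h0 + (x₃ * y₁ - x₁ * y₃) * h1 + (x₁ * y₂ - x₂ * y₁) * h2
  have hnz := mul_ne_zero hs hdR
  intro i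
  fin_cases i
  · exact (mul_eq_zero.1 e0).resolve_right hnz
  · exact (mul_eq_zero.1 e1).resolve_right hnz
  · exact (mul_eq_zero.1 e2).resolve_right hnz

/-- **The cocycle's independence hypothesis from a chart**: three pattern points charted to model points with non-zero integer determinant are linearly
independent (used with `…Exact.exactDict_cocycle`; the determinant is a kernel computation). [this file] -/
theorem linearIndependent_of_chart (M : EuclideanSpace ℝ (Fin 3) →ₗᵢ[ℝ] EuclideanSpace ℝ (Fin 3)) {p q r : EuclideanSpace ℝ (Fin 3)} {X Y Z : T3}
    (hp : M p = mv X) (hq : M q = mv Y) (hr : M r = mv Z) (hd : tdet X Y Z ≠ 0) : LinearIndependent ℝ ![p, q, r] := by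
  apply LinearIndependent.of_comp M.toLinearMap
  have hc3 : (M.toLinearMap : EuclideanSpace ℝ (Fin 3) → EuclideanSpace ℝ (Fin 3)) ∘ ![p, q, r] = ![mv X, mv Y, mv Z] := by
    funext i
    fin_cases i <;> simp [hp, hq, hr]
  rw [hc3]
  exact linearIndependent_mv hd

end Summit.AtomisticToContinuum.Crystallization.Theorems.OverbindingBudgetAffineCompressedCutCharts
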